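import Summits.ABC.IUTFork.Conditional.LayerC312OfS
import Summits.ABC.IUTFork.Cor312NaiveProvPinnedWitness

/-!
# Branch C — layer certificate C312: its NON-S binders are inhabited at EVERY GENUINE initial Θ-datum, with S and the conclusion failing
# (provenance-level vacuity audit; rung LADDER-ABC:A2.C)

Companion of `Conditional/LayerC312OfS.lean` (p428164) and `Conditional/LayerC312OfSNonVacuity.lean` (p428985, TOY level: w5-d247's P♭/P♯
over `naiveFull 2`). abc-iut-c312-2 (gen 4). PROOF-ONLY (0 definitions). CO-IMPORT SIDE B of abc-iut-w5-d104's breaker F1 (imports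
abc-iut-w4-d026's `Cor312NaiveProvPinnedWitness`, side B; the counted certificate itself is neutral) — do not co-import with side-A modules.

THIS FILE PROVES NOTHING NEW about [IUTchIII] §3 AND ASSERTS NOTHING about any author. It lifts the [S]-load-bearing half of the vacuity
audit from the toy to the PROVENANCE level, BY NAME, using abc-iut-w4-d026's `NaiveProv.pinned_countermodel_isSettingOf` (p427703 lineage:
for EVERY initial Θ-datum `D : InitialThetaData F K Fbar E l Pb` ([IUTchI] Def 3.1, abc-iut-L5-t2 — REAL at Mathlib level) there are, over
its index skeleton `Thm311.Real.thetaIndexOfInitial D`, a contentful typed-Thm-3.11 instance `F₁` (`F₁.Statement`) and a pin-respecting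
verbatim setting `P` OF `D` (`Cor312Prov.IsSettingOf D P`, abc-iut-c312-8) with bridge hypotheses, `|log(q)| > 0`, the three pins, at which
`PilotKummerIndRelated` and the Corollary-as-typed FAIL):
* `layerC312_nonS_binders_at_every_datum` — at every genuine `D`, the certificate's NON-S binders [PIN] `PinnedRegions3`, `BridgeHyps`,
  [CONE] `DAG.N_IUTchIII_Thm3_11 F₁` are JOINTLY INHABITED by a setting OF `D`, together with `¬ S` and `¬ Statement` there;
* `layerC312_without_S_not_derivable_at_datum` — hence, FOR EVERY genuine `D`, «pins + bridge + Thm 3.11 as typed ⟹ Cor 3.12 as typed» FAILS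
  at some setting of `D`: the [S] binder is load-bearing datum by datum, not only at one toy;
* `layerC312_certificate_content_at_datum` — packaged: at every `D` the certificate `layerC312_of_S` is an implication whose antecedent
  minus [S] holds at a setting of `D` and whose conclusion fails there — its content at genuine data sits exactly in [S]
  (concordant with abc-iut-w4-d026's apex-level `ApexNonVacuity.exists_sideData_of_datum`, p430256).
HONEST SCOPE: `F₁` is w4-d026's NAIVE contentful instance over the datum's skeleton (interface + provenance level: the setting's NUMBERS are
the datum's by `IsSettingOf`; the situation's objects are naive models, not the genuine Hodge theaters of `D`); nothing says the GENUINE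
situation of `D` satisfies or violates anything. no side taken on [IUTchIII] Cor. 3.12; instantiated ≠ endorsed; typed ≠ proved.
[claim: Mochizuki2012, status: disputed] [cite: ScholzeStix2018, §2.2 pp. 9–10]
-/

noncomputable section

namespace Summit.ABC.IUTFork.Conditional

open Thm311 Cor312 Cor312Vol Cor312Vol.NaiveProv DAG Literature.IUT.HodgeTheaters Literature.IUT.LogThetaLattice

variable {F K Fbar : Type} [Field F] [NumberField F] [Field K] [NumberField K] [Algebra F K] [Field Fbar] [Algebra F Fbar]
  [Algebra K Fbar] {E : WeierstrassCurve F} [E.IsElliptic] {l : ℕ} {Pb : BadPlacePredicates K}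

/-- **At EVERY genuine initial Θ-datum `D`, the NON-S binders of `layerC312_of_S` are jointly inhabited by a verbatim setting OF `D`
(`IsSettingOf`), with `|log(q)| > 0`, while S and [IUTchIII] Cor. 3.12 as typed FAIL there** — abc-iut-w4-d026's
`pinned_countermodel_isSettingOf` BY NAME. [claim: Mochizuki2012, status: disputed] -/
theorem layerC312_nonS_binders_at_every_datum (D : InitialThetaData F K Fbar E l Pb) :
    ∃ (F₁ : FullSituation (Thm311.Real.thetaIndexOfInitial D)) (Pc : Cor312.Setting F₁.toLatticeSituation.toSituation)
      (ρ : (∀ v : (Thm311.Real.thetaIndexOfInitial D).V, v ∈ (Thm311.Real.thetaIndexOfInitial D).Vbad → Set (F₁.L.StarPacket v)) →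
        ∀ (j : (Thm311.Real.thetaIndexOfInitial D).Label) (vQ : (Thm311.Real.thetaIndexOfInitial D).VQ), Set (F₁.L.Packet j vQ))
      (qK : ∀ v : (Thm311.Real.thetaIndexOfInitial D).V, v ∈ (Thm311.Real.thetaIndexOfInitial D).Vbad → Set (F₁.L.StarPacket v)),
      Cor312Prov.IsSettingOf D Pc ∧ PinnedRegions3 F₁.toLatticeSituation Pc ρ qK ∧ BridgeHyps Pc ∧ DAG.N_IUTchIII_Thm3_11 F₁ ∧
        Pc.AbsLogQPos ∧ ¬ PilotKummerIndRelated F₁.toLatticeSituation Pc ρ qK ∧ ¬ Pc.Statement := by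
  obtain ⟨F₁, P, ρ, qK, hSet, hF, -, -, -, -, hB, hA, -, hpin, -, -, -, hres, -, -, hS, -, -, -⟩ :=
    pinned_countermodel_isSettingOf D
  exact ⟨F₁, P, ρ, qK, hSet, hpin, hB, hF, hA, hres, hS⟩

/-- **For EVERY genuine `D`, «three pins + bridge hypotheses + Thm 3.11 as typed ⟹ the four C312 cone members» FAILS at a verbatim setting
of `D`**: the certificate with its [S] binder deleted is refuted datum by datum (provenance level), not only at one toy.
[claim: Mochizuki2012, status: disputed] -/
theorem layerC312_without_S_not_derivable_at_datum (D : InitialThetaData F K Fbar E l Pb) :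
    ¬ ∀ (F₁ : FullSituation (Thm311.Real.thetaIndexOfInitial D)) (Pc : Cor312.Setting F₁.toLatticeSituation.toSituation)
        (ρ : (∀ v : (Thm311.Real.thetaIndexOfInitial D).V, v ∈ (Thm311.Real.thetaIndexOfInitial D).Vbad → Set (F₁.L.StarPacket v)) →
          ∀ (j : (Thm311.Real.thetaIndexOfInitial D).Label) (vQ : (Thm311.Real.thetaIndexOfInitial D).VQ), Set (F₁.L.Packet j vQ))
        (qK : ∀ v : (Thm311.Real.thetaIndexOfInitial D).V, v ∈ (Thm311.Real.thetaIndexOfInitial D).Vbad → Set (F₁.L.StarPacket v)),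
        Cor312Prov.IsSettingOf D Pc → PinnedRegions3 F₁.toLatticeSituation Pc ρ qK → BridgeHyps Pc → DAG.N_IUTchIII_Thm3_11 F₁ →
          DAG.N_IUTchIII_Thm3_11_i F₁.toLatticeSituation.toSituation ∧ DAG.N_IUTchIII_Thm3_11_ii F₁.toLatticeSituation ∧
            DAG.N_IUTchIII_Thm3_11_iii F₁ ∧ Pc.Statement := by
  intro h
  obtain ⟨F₁, Pc, ρ, qK, hSet, hpin, hB, hF, -, -, hS⟩ := layerC312_nonS_binders_at_every_datum D
  exact hS (h F₁ Pc ρ qK hSet hpin hB hF).2.2.2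

/-- **PACKAGED, per genuine datum**: at every `D` there is a verbatim setting OF `D` at which (a) the certificate `layerC312_of_S` APPLIES as
an implication (its non-S binders hold), (b) its [S] binder FAILS and (c) its conclusion FAILS — so at genuine data the certificate's content
sits exactly in [S] (= `PilotKummerIndRelated`), concordant with the apex-level row of abc-iut-w4-d026 (p430256). No side taken.
[claim: Mochizuki2012, status: disputed] -/
theorem layerC312_certificate_content_at_datum (D : InitialThetaData F K Fbar E l Pb) :
    ∃ (F₁ : FullSituation (Thm311.Real.thetaIndexOfInitial D)) (Pc : Cor312.Setting F₁.toLatticeSituation.toSituation)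
      (ρ : (∀ v : (Thm311.Real.thetaIndexOfInitial D).V, v ∈ (Thm311.Real.thetaIndexOfInitial D).Vbad → Set (F₁.L.StarPacket v)) →
        ∀ (j : (Thm311.Real.thetaIndexOfInitial D).Label) (vQ : (Thm311.Real.thetaIndexOfInitial D).VQ), Set (F₁.L.Packet j vQ))
      (qK : ∀ v : (Thm311.Real.thetaIndexOfInitial D).V, v ∈ (Thm311.Real.thetaIndexOfInitial D).Vbad → Set (F₁.L.StarPacket v)),
      Cor312Prov.IsSettingOf D Pc ∧
      -- (a) the certificate applies: S would give the four cone members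
      (PilotKummerIndRelated F₁.toLatticeSituation Pc ρ qK →
        DAG.N_IUTchIII_Thm3_11_i F₁.toLatticeSituation.toSituation ∧ DAG.N_IUTchIII_Thm3_11_ii F₁.toLatticeSituation ∧
          DAG.N_IUTchIII_Thm3_11_iii F₁ ∧ Pc.Statement) ∧
      -- (b) S fails there, (c) and so does the Corollary as typed
      ¬ PilotKummerIndRelated F₁.toLatticeSituation Pc ρ qK ∧ ¬ Pc.Statement := by
  obtain ⟨F₁, Pc, ρ, qK, hSet, hpin, hB, hF, -, hres, hS⟩ := layerC312_nonS_binders_at_every_datum D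
  exact ⟨F₁, Pc, ρ, qK, hSet, fun hSr => layerC312_of_S F₁ Pc ρ qK hSr hpin hB hF, hres, hS⟩

end Summit.ABC.IUTFork.Conditional

end
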